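import Mathlib
import Literature.NumberTheory.Sieve.ParityWave0
import Summits.Parity.GeneralizedHardyLittlewood.Theorems.LiouvilleShiftedTablesEHStubLowConductor

/-!
# Log-sparse top-window purity FROM the Elliott–Halberstam estimate (crux `EH`, stmt-Parity-11314)

Line `upward-replication-free-factorability`, log-sparse variant (lead c1).  The converse of the
line's descent: the Wave0 Elliott–Halberstam estimate `Literature.NumberTheory.Sieve.EH θ₀` at ONE
level `θ₀ ∈ (1 − ε', 1)` already forces, for every conductor cut `δ₀ ∈ (0, 1/2)` and all reals `B, B'`,
LOG-sparse purity of the conductor-excised discrepancy in the window of moduli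
`m ∈ (x^{1−ε'}, 2x^{1−ε'}]`: all but `≤ x^{1−ε'}/(log x)^{B'}` of them satisfy
`E♯(x; m) := max_{a unit} ‖φ(m)⁻¹ ∑_{χ mod m, cond χ > ⌊x^{1/2−δ₀}⌋} χ(a⁻¹) ψ(x, χ)‖ < x/(φ(m)(log x)^B)`.

Proof (Markov).  Pointwise `E♯(x; m) ≤ max_a |Δ(x; m, a)| + E♭(x; m)` (triangle inequality under
the maximum, `E♭ = max_a ‖Δ − Δ♯‖`); summed over the window (inside `q ≤ x^{θ₀}` for large `x`) this
is `≤ (C + C') x/(log x)^A` by `EH θ₀` and the landed `LowConductor.stub_lowConductor` (low conductors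
are harmless at every level `θ₀ < 1`), for any `A > 0`.  An impure `m` has
`E♯(x; m) ≥ x/(φ(m)(log x)^B) ≥ x/(2x^{1−ε'}(log x)^B)`, so with `A = max(B + B' + 1, 1)` the impure
moduli number `≤ 2(C + C') x^{1−ε'} (log x)^{B−A} ≤ x^{1−ε'}/(log x)^{B'}` once `log x ≥ 2(C + C')`.

Together with the descent of the line this makes log-sparse top-window purity an EQUIVALENT normal
form of the Elliott–Halberstam conjecture (file `LiouvilleShiftedTablesEHLocalisation.lean`).

References: H. Davenport, *Multiplicative Number Theory*, ch. 28; the line card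
`Cruxes/EH/Lines/upward-replication-free-factorability.md`.
-/

open Finset Real Filter Asymptotics

namespace Summit.Parity.GeneralizedHardyLittlewood.Theorems.EH.PurityLogOfEH

open Literature.NumberTheory.Sieve

/-- Triangle inequality under a finite maximum, the other way round:
`max_i ‖v i‖ ≤ max_i |f i| + max_i ‖f i − v i‖`. [folklore] -/
theorem ciSup_norm_le_ciSup_abs_add {ι : Type*} [Finite ι] [Nonempty ι] (f : ι → ℝ) (v : ι → ℂ) :
    ⨆ i, ‖v i‖ ≤ (⨆ i, |f i|) + ⨆ i, ‖((f i : ℝ) : ℂ) - v i‖ := by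
  refine ciSup_le fun i => ?_
  calc ‖v i‖ ≤ ‖((f i : ℝ) : ℂ)‖ + ‖((f i : ℝ) : ℂ) - v i‖ := norm_le_insert _ _
    _ = |f i| + ‖((f i : ℝ) : ℂ) - v i‖ := by rw [Complex.norm_real, Real.norm_eq_abs]
    _ ≤ _ := add_le_add (le_ciSup (Finite.bddAbove_range fun i => |f i|) i)
          (le_ciSup (Finite.bddAbove_range fun i => ‖((f i : ℝ) : ℂ) - v i‖) i)

/-- Markov's inequality for a finite family: if `t ≤ g m` on `I` and `∑_{m ∈ I} g m ≤ S` with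
`t > 0`, then `#I ≤ S / t`. [folklore] -/
theorem card_le_div_of_le_sum {I : Finset ℕ} {g : ℕ → ℝ} {t S : ℝ} (ht : 0 < t)
    (hI : ∀ m ∈ I, t ≤ g m) (hS : ∑ m ∈ I, g m ≤ S) : (I.card : ℝ) ≤ S / t := by
  rw [le_div_iff₀ ht]
  calc (I.card : ℝ) * t = ∑ _m ∈ I, t := by rw [Finset.sum_const, nsmul_eq_mul]
    _ ≤ ∑ m ∈ I, g m := Finset.sum_le_sum hI
    _ ≤ S := hS

/-- The eventual side conditions in `x`: `x ≥ 2`, `log x ≥ L₀`, and the window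
`(x^{1−ε'}, 2x^{1−ε'}]` lies below the level `x^{θ₀}` (`2 x^{1−ε'} ≤ x^{θ₀}`, from
`x^{θ₀−(1−ε')} → ∞`). [folklore] -/
theorem eventually_window_conds {ε' θ₀ : ℝ} (h : 1 - ε' < θ₀) (L₀ : ℝ) :
    ∀ᶠ x : ℝ in atTop, 2 ≤ x ∧ L₀ ≤ Real.log x ∧ 2 * x ^ (1 - ε') ≤ x ^ θ₀ := by
  refine (eventually_ge_atTop 2).and ((Real.tendsto_log_atTop.eventually_ge_atTop L₀).and ?_)
  have hpos : 0 < θ₀ - (1 - ε') := by linarith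
  filter_upwards [(tendsto_rpow_atTop hpos).eventually_ge_atTop 2, eventually_gt_atTop 0]
    with x hx hx0
  calc 2 * x ^ (1 - ε') ≤ x ^ (θ₀ - (1 - ε')) * x ^ (1 - ε') :=
        mul_le_mul_of_nonneg_right hx (Real.rpow_nonneg hx0.le _)
    _ = x ^ θ₀ := by rw [← Real.rpow_add hx0]; ring_nf

/-- **Log-sparse purity of one window from the Elliott–Halberstam estimate above it.**  For
`ε' > 0` and a level `θ₀ ∈ (1 − ε', 1)` with `EH θ₀` (Wave0 form), every conductor cut
`δ₀ ∈ (0, 1/2)` and all reals `B, B'`: for `x ≥ x₀` there is a set `I` of at most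
`x^{1−ε'}/(log x)^{B'}` moduli such that every `m ∈ (x^{1−ε'}, 2x^{1−ε'}]`, `m ∉ I`, satisfies
`max_a ‖φ(m)⁻¹ ∑_{cond χ > ⌊x^{1/2−δ₀}⌋} χ(a⁻¹) ψ(x, χ)‖ < x/(φ(m)(log x)^B)` (Markov on
`E♯ ≤ max_a |Δ| + E♭`, with `LowConductor.stub_lowConductor` for `E♭`). [folklore] -/
theorem purityLog_of_ehAt (ε' θ₀ : ℝ) (hθ₀ : 1 - ε' < θ₀) (hθ₀1 : θ₀ < 1)
    (hEH : Literature.NumberTheory.Sieve.EH θ₀) :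
    ∀ δ₀ : ℝ, 0 < δ₀ → δ₀ < 1 / 2 → ∀ B B' : ℝ, ∃ x₀ : ℝ, ∀ x : ℝ, x₀ ≤ x →
      ∃ I : Finset ℕ, (I.card : ℝ) ≤ x ^ (1 - ε') / Real.log x ^ B' ∧
        ∀ m ∈ Finset.Ioc ⌊x ^ (1 - ε')⌋₊ ⌊2 * x ^ (1 - ε')⌋₊, m ∉ I →
          (⨆ a : (ZMod m)ˣ,
              ‖((Nat.totient m : ℂ))⁻¹ *
                  ∑ χ ∈ (Finset.univ : Finset (DirichletCharacter ℂ m)) with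
                      ⌊x ^ (1 / 2 - δ₀)⌋₊ < χ.conductor,
                    χ (a : ZMod m)⁻¹ * Literature.NumberTheory.Sieve.chebyshevPsiChar χ x‖) <
            x / ((Nat.totient m : ℝ) * Real.log x ^ B) := by
  classical
  intro δ₀ hδ₀ hδ₀' B B'
  set A : ℝ := max (B + B' + 1) 1 with hA
  have hA0 : 0 < A := lt_of_lt_of_le one_pos (le_max_right _ _)
  obtain ⟨C, hC⟩ := (hEH A).bound
  obtain ⟨C', hC'⟩ := (LowConductor.stub_lowConductor δ₀ hδ₀ hδ₀' θ₀ hθ₀1 A hA0).bound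
  obtain ⟨x₀, hx₀⟩ := Filter.eventually_atTop.1
    (hC.and (hC'.and (eventually_window_conds hθ₀ (2 * (max C 0 + max C' 0) + 1))))
  refine ⟨x₀, fun x hx => ?_⟩
  obtain ⟨hCx, hC'x, hx2, hL, hwin⟩ := hx₀ x hx
  -- notation
  set L := Real.log x with hLdef
  set X := x ^ (1 - ε') with hXdef
  set D := ⌊x ^ (1 / 2 - δ₀)⌋₊ with hDdef
  set W := Finset.Ioc ⌊X⌋₊ ⌊2 * X⌋₊ with hWdef
  set Es : ℕ → ℝ := fun m => ⨆ a : (ZMod m)ˣ,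
      ‖((Nat.totient m : ℂ))⁻¹ *
          ∑ χ ∈ (Finset.univ : Finset (DirichletCharacter ℂ m)) with D < χ.conductor,
            χ (a : ZMod m)⁻¹ * chebyshevPsiChar χ x‖ with hEsdef
  set T : ℕ → ℝ := fun q => ⨆ a : (ZMod q)ˣ,
      |ParityWave0.chebyshevPsiMod q a x - x / Nat.totient q| with hTdef
  set Eb : ℕ → ℝ := fun q => ⨆ a : (ZMod q)ˣ,
      ‖((ParityWave0.chebyshevPsiMod q (a : ZMod q) x - x / (Nat.totient q : ℝ) : ℝ) : ℂ) -
        ((Nat.totient q : ℂ))⁻¹ *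
          ∑ χ ∈ (Finset.univ : Finset (DirichletCharacter ℂ q)) with D < χ.conductor,
            χ (a : ZMod q)⁻¹ * chebyshevPsiChar χ x‖ with hEbdef
  have hx0 : 0 < x := by linarith
  have hx1 : 1 ≤ x := by linarith
  have hL1 : 1 ≤ L := by
    have h0 : 0 ≤ max C 0 + max C' 0 := add_nonneg (le_max_right _ _) (le_max_right _ _)
    linarith
  have hL0 : 0 < L := by linarith
  have hX0 : 0 < X := Real.rpow_pos_of_pos hx0 _
  have hLB : 0 < L ^ B := Real.rpow_pos_of_pos hL0 B
  have hLA : 0 < L ^ A := Real.rpow_pos_of_pos hL0 A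
  -- the exceptional set: the impure moduli of the window
  set I := W.filter (fun m => x / ((Nat.totient m : ℝ) * L ^ B) ≤ Es m) with hIdef
  refine ⟨I, ?_, fun m hm hmI => ?_⟩
  swap
  · -- purity off `I` is the definition of `I`
    have : ¬ (x / ((Nat.totient m : ℝ) * L ^ B) ≤ Es m) := fun h =>
      hmI (Finset.mem_filter.2 ⟨hm, h⟩)
    exact lt_of_not_ge this
  -- the size of `I` by Markov
  -- (1) the window lies in `[1, x^{θ₀}]`
  have hWsub : W ⊆ Finset.Icc 1 ⌊x ^ θ₀⌋₊ := by
    intro m hm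
    rw [hWdef, Finset.mem_Ioc] at hm
    refine Finset.mem_Icc.2 ⟨by omega, hm.2.trans (Nat.floor_le_floor hwin)⟩
  -- (2) pointwise `E♯ ≤ T + E♭` on `[1, x^{θ₀}]`
  have hpt : ∀ q ∈ Finset.Icc 1 ⌊x ^ θ₀⌋₊, Es q ≤ T q + Eb q := by
    intro q hq
    haveI : NeZero q := ⟨by have := (Finset.mem_Icc.1 hq).1; omega⟩
    exact ciSup_norm_le_ciSup_abs_add _ _
  -- (3) the two averaged bounds at height `x`
  have hsumT : ∑ q ∈ Finset.Icc 1 ⌊x ^ θ₀⌋₊, T q ≤ max C 0 * (x / L ^ A) := by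
    have h := hCx
    rw [Real.norm_of_nonneg (Finset.sum_nonneg fun q _ => Real.iSup_nonneg fun a => abs_nonneg _),
      Real.norm_of_nonneg (div_nonneg hx0.le hLA.le)] at h
    exact h.trans (mul_le_mul_of_nonneg_right (le_max_left _ _) (div_nonneg hx0.le hLA.le))
  have hsumEb : ∑ q ∈ Finset.Icc 1 ⌊x ^ θ₀⌋₊, Eb q ≤ max C' 0 * (x / L ^ A) := by
    have h := hC'x
    rw [Real.norm_of_nonneg (Finset.sum_nonneg fun q _ => Real.iSup_nonneg fun a => norm_nonneg _),
      Real.norm_of_nonneg (div_nonneg hx0.le hLA.le)] at h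
    exact h.trans (mul_le_mul_of_nonneg_right (le_max_left _ _) (div_nonneg hx0.le hLA.le))
  -- (4) the sum of `E♯` over `I`
  have hsumI : ∑ m ∈ I, Es m ≤ (max C 0 + max C' 0) * (x / L ^ A) := by
    have hIW : I ⊆ W := Finset.filter_subset _ _
    calc ∑ m ∈ I, Es m ≤ ∑ m ∈ Finset.Icc 1 ⌊x ^ θ₀⌋₊, Es m :=
          Finset.sum_le_sum_of_subset_of_nonneg (hIW.trans hWsub)
            fun m _ _ => Real.iSup_nonneg fun a => norm_nonneg _
      _ ≤ ∑ m ∈ Finset.Icc 1 ⌊x ^ θ₀⌋₊, (T m + Eb m) := Finset.sum_le_sum hpt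
      _ ≤ max C 0 * (x / L ^ A) + max C' 0 * (x / L ^ A) := by
          rw [Finset.sum_add_distrib]; exact add_le_add hsumT hsumEb
      _ = (max C 0 + max C' 0) * (x / L ^ A) := by ring
  -- (5) the threshold on `I`: `x/(2X L^B) ≤ E♯(m)` since `φ(m) ≤ m ≤ 2X`
  have hthr : ∀ m ∈ I, x / (2 * X * L ^ B) ≤ Es m := by
    intro m hm
    obtain ⟨hmW, hmE⟩ := Finset.mem_filter.1 hm
    rw [hWdef, Finset.mem_Ioc] at hmW
    have hm1 : 1 ≤ m := by omega
    have hφ0 : (0 : ℝ) < Nat.totient m := by exact_mod_cast Nat.totient_pos.2 hm1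
    have hφ : (Nat.totient m : ℝ) ≤ 2 * X :=
      calc (Nat.totient m : ℝ) ≤ m := by exact_mod_cast Nat.totient_le m
        _ ≤ ⌊2 * X⌋₊ := by exact_mod_cast hmW.2
        _ ≤ 2 * X := Nat.floor_le (by positivity)
    refine le_trans ?_ hmE
    exact div_le_div_of_nonneg_left hx0.le (by positivity)
      (mul_le_mul_of_nonneg_right hφ hLB.le)
  -- (6) Markov and the comparison of powers of `log x`
  have ht : 0 < x / (2 * X * L ^ B) := by positivity
  have hcard := card_le_div_of_le_sum ht hthr hsumI
  have hK0 : 0 ≤ max C 0 + max C' 0 := add_nonneg (le_max_right _ _) (le_max_right _ _)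
  have hLK : 2 * (max C 0 + max C' 0) ≤ L := by linarith
  have hAB : B + B' + 1 ≤ A := le_max_left _ _
  calc (I.card : ℝ) ≤ (max C 0 + max C' 0) * (x / L ^ A) / (x / (2 * X * L ^ B)) := hcard
    _ = 2 * (max C 0 + max C' 0) * X * (L ^ B / L ^ A) := by
        field_simp
    _ ≤ L * X * (L ^ B / L ^ A) := by gcongr
    _ = X * (L ^ (B + 1) / L ^ A) := by
        rw [Real.rpow_add hL0, Real.rpow_one]; ring
    _ ≤ X * (L ^ (B + 1) / L ^ (B + B' + 1)) := by gcongr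
    _ = X / L ^ B' := by
        rw [show B + B' + 1 = (B + 1) + B' by ring, Real.rpow_add hL0 (B + 1) B']
        have h1 : 0 < L ^ (B + 1) := Real.rpow_pos_of_pos hL0 _
        field_simp

/-- **The registered log-sparse purity stub follows from the Elliott–Halberstam conjecture**
(Wave0 form `∀ θ < 1, EH θ`): for `0 < ε' ≤ 1/2` take `θ₀ = 1 − ε'/2` in `purityLog_of_ehAt`
(any `δ₀`, here `1/4`).  This is the converse making the log-sparse line an equivalence. [folklore] -/
theorem stub_topWindowPurityLog_of_eh
    (hEH : Literature.NumberTheory.Sieve.ElliottHalberstamConjecture) :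
    ∀ ε' : ℝ, 0 < ε' → ε' ≤ 1 / 2 → ∀ B : ℝ, 0 < B → ∀ B' : ℝ, 0 < B' →
      ∃ δ₀ : ℝ, 0 < δ₀ ∧ δ₀ < 1 / 2 ∧ ∃ x₀ : ℝ, ∀ x : ℝ, x₀ ≤ x →
        ∃ I : Finset ℕ, (I.card : ℝ) ≤ x ^ (1 - ε') / Real.log x ^ B' ∧
          ∀ m ∈ Finset.Ioc ⌊x ^ (1 - ε')⌋₊ ⌊2 * x ^ (1 - ε')⌋₊, m ∉ I →
            (⨆ a : (ZMod m)ˣ,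
                ‖((Nat.totient m : ℂ))⁻¹ *
                    ∑ χ ∈ (Finset.univ : Finset (DirichletCharacter ℂ m)) with
                        ⌊x ^ (1 / 2 - δ₀)⌋₊ < χ.conductor,
                      χ (a : ZMod m)⁻¹ * Literature.NumberTheory.Sieve.chebyshevPsiChar χ x‖) <
              x / ((Nat.totient m : ℝ) * Real.log x ^ B) := by
  intro ε' hε' _hε2 B _hB B' _hB'
  refine ⟨1 / 4, by norm_num, by norm_num, ?_⟩
  exact purityLog_of_ehAt ε' (1 - ε' / 2) (by linarith) (by linarith)
    (hEH (1 - ε' / 2) (by linarith)) (1 / 4) (by norm_num) (by norm_num) B B'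

end Summit.Parity.GeneralizedHardyLittlewood.Theorems.EH.PurityLogOfEH
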